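import Mathlib.CategoryTheory.Category.Cat
import Literature.IUT.LogThetaLattice.GlobalLGPFrobenioidsWeightedDiagonal
import Literature.IUT.LogThetaLattice.ThetaPilotObjectsFrakSignature
import HarnessLib

/-!
# [IUTchIII] Proposition 3.7 (iii)–(v) at the CATEGORY level over the number-field model, B: the object-forming
# algorithm of (v) through the realification FUNCTOR of [FrdI] Prop. 5.3 from INTEGRAL local fractional ideals,
# and the categorical inhabitant `frobenioidSignature` of `GlobalLGPFrobenioidSignature` (abc-iut cell, layer L6,
# typer-of-record lineage abc-iut-L6-t4; SUBDAG-IUTchIII-Prop-37 "Frobenioid (categorical) level"; part A =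
# `GlobalLGPFrobenioidsWeightedDiagonal.lean`)

S. Mochizuki, *Inter-universal Teichmüller theory III*, kurims manuscript (May 2020), §3, Proposition 3.7 (v),
p. 111 l. 79 – p. 112 l. 8 [claim: Mochizuki2012, status: disputed], read on the page (own render
`paper:url-4b091feeb646` p0111–p0112): "In particular, by applying the definition of `(†𝓕⊛_𝔪𝔬𝔡)_j` — i.e., in
terms of local fractional ideals [cf. (ii)] — together with the products of realification functors
`Π_{j∈𝔽_l^⋇} (†𝓕⊛_𝔪𝔬𝔡)_j → Π_{j∈𝔽_l^⋇} (†𝓕⊛ℝ_𝔪𝔬𝔡)_j` [cf. [FrdI], Proposition 5.3], one obtains an algorithm for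
constructing, in a fashion compatible [in the evident sense] with the local isomorphisms `{†ρ_{lgp,v}}_{v∈𝕍}`,
`{†ρ_{LGP,v}}_{v∈𝕍}` of (iii) and (iv), objects of the [global!] categories `𝒞^⊩_lgp(†𝓗𝓣^{Θ±ell}NF)`,
`𝒞^⊩_LGP(†𝓗𝓣^{Θ±ell}NF)` from the local fractional ideals generated by elements of the monoids [cf. (iv);
Proposition 3.4, (ii)] `Ψ_{𝓕_lgp}(†𝓗𝓣^{Θ±ell}NF)_v` for `v ∈ 𝕍^bad`"; Definition 3.8 (i) p. 112 l. 26–35: "the object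
of `Π_{j∈𝔽_l^⋇} (†𝓕⊛_MOD)_j` or `Π_{j∈𝔽_l^⋇} (†𝓕⊛_𝔪𝔬𝔡)_j` — as well as its realification, regarded as an object of
`†𝒞^⊩_LGP` … or `†𝒞^⊩_lgp` … [cf. Proposition 3.7, (iii), (iv), (v)] — determined by any collection, indexed by
`v ∈ 𝕍^bad`, of generators up to torsion of the monoids `Ψ^⊥_{𝓕_lgp}(†𝓗𝓣^{Θ±ell}NF)_v` as a Θ-pilot object".

WHAT THE TREE HAD (inputs, consumed BY NAME). abc-iut-L6-t4 typed Prop. 3.7 as the OUTPUT SIGNATURE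
`GlobalLGPFrobenioidSignature` (`ThetaPilotObjects.lean`), inhabited at the Dupuy–Hilado divisor level
(`divisorSignatureRoot`) and at the object level of the model Frobenioid (abc-iut-w4-d015 `frakSignatureRoot`:
Frobenioids = NAMES with object types, realification = identity on real classes, `ℤ`-exponents
`idealExponents`, model objects `objOfFrakModel`). The CATEGORIES at the number-field model: `(†𝓕⊛_𝔪𝔬𝔡)_α` =
abc-iut-L6-t6's `FrakCat` on abc-iut-w4-d005's INTEGRAL datum (`Γ_v = ℤ` at finite, `ℝ` at archimedean places:
`Prop37.Ffrak F`), equivalent to the [FrdI] Thm. 5.2 model `(†𝓕⊛_mod)_α` (`Prop37.isoFrakMod`) and to the torsor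
version `(†𝓕⊛_MOD)_α` (abc-iut-L6-t6 `toMOD`; part A `isoFrakMODCat`); the realification `(†𝓕⊛ℝ_𝔪𝔬𝔡)_α` =
abc-iut-w5-d153's `Prop37.FrakRlfCat F` with THE realification functor `Prop37.realification F`; part A's
weighted-diagonal embedding functor `embDiag`.

WHAT THIS FILE ADDS (no `Prop`-valued definition; nothing assumed):
* §3 the object-forming algorithm of (v) THROUGH THE REALIFICATION FUNCTOR from INTEGRAL local fractional
  ideals: `ofExponents N` = the object `Π_v 𝔭_v^{N(v)}` of `(†𝓕⊛_𝔪𝔬𝔡)_α` (`Γ_v = ℤ`); `idealObj X g j` = the one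
  "generated by" `g_{v,j}` at `v ∈ 𝕍^bad`; the junction **`realifyObj_ofExponents` / `realification_idealObj`**:
  its realification IS abc-iut-w4-d015's model object `objOfFrakModel X g j`; and, for elements `g` of the
  printed splitting monoids `Ψ^⊥_v = μ_{2l}^{diag}·ξ_v^ℕ` (`SplittingMonoids.dhRoot`),
  **`realification_idealObj_eq_embDiag`**: the realified ideal family IS the weighted-diagonal image of ONE
  object `lgpObj X g` of `†𝒞^⊩_lgp` — Def. 3.8 (i)'s "its realification, regarded as an object of `†𝒞^⊩_LGP` or
  `†𝒞^⊩_lgp`" (via `ordv_eq_sqWt_mul_of_mem`: `ord_v(g_{v,j}) = j²·ord_v(g_{v,1})` on `Ψ^⊥_v`).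
* §4 **`frobenioidSignature X`**: the inhabitant of `GlobalLGPFrobenioidSignature` whose Frobenioids are the
  genuine CATEGORIES (`catOf`, valued in Mathlib's `Cat`), whose isomorphisms of Frobenioids are EQUIVALENCES
  OF CATEGORIES, whose realification is name-level [FrdI] Prop. 5.3 (`(†𝓕⊛_*)_j ↦ (†𝓕⊛ℝ_*)_j = FrakRlfCat F`,
  functor `realifyFunctorFrak`), whose realified product embeddings are `embDiag` on objects and whose
  object-forming maps are `idealObj` / `lgpObj`; its Θ-pilot object (Def. 3.8 (i)) is identified for the
  printed splitting monoids (`thetaPilotObject_frobenioidSignature`: underlying real family = `ofFinDivisorFrak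
  X.qPilot`; embedded image = `(ofLgpDivisor X.thetaPilot)_j`, abc-iut-c312-3's `P_Θ = (j²·P_q)_j`), WELL-DEFINED
  (`thetaPilotObject_wellDefined_frobenioidSignature`), and the square of (v) on these objects
  (`frobenioidSignature_square`).

HONEST FRAMING / NOT HERE (named residuals of the lineage): (a) print IDENTIFIES `(†𝓕⊛_mod)_α`, `(†𝓕⊛_MOD)_α` with
`(†𝓕⊛_𝔪𝔬𝔡)_α` along the natural isomorphisms of (i)(ii) ("We shall often use this isomorphism of Frobenioids to
identify", p. 110 l. 22; Rmk. 3.6.2 (ii)) and so does `catOf`; the tree's DISTINCT models and their equivalences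
are `Prop37.isoFrakMod` ([FrdI] Thm. 5.2 model) and part A's `isoFrakMODCat` (torsor version); (b) the
identification of `Prop37.realification` with layer L1's abstract `PreFrobenioid.realification` over the
one-morphism base, and (c) the compatibility "with the local isomorphisms `{†ρ_{lgp,v}}`" of the
`𝓕^⊩`-prime-strip (abc-iut-L5-t2 `InitialThetaData.rho`, a different parametrisation of the places; at the level
typed here the `v`-component of the global object IS the exponent `ord_v(g_{v,j})` of the local ideal,
abc-iut-w4-d015's `frakDivisor_objOfFrakModel_inr`) are NOT constructed here. Nothing in this file asserts a
disputed claim or takes a side on [IUTchIII] Cor. 3.12; typed ≠ discharged; instantiated ≠ endorsed.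
-/

noncomputable section

namespace Literature.IUT.LogThetaLattice

namespace Prop37

open CategoryTheory NumberField IsDedekindDomain GlobalFrobenioidModels Literature.IUT.LogVolume
open Literature.IUT.HodgeArakelov Literature.NumberTheory.EllipticCurves
open Literature.AlgebraicGeometry.Frobenioids (Places)

variable (F : Type) [Field F] [NumberField F]

/-! ### §3 Prop. 3.7 (v): objects of the global categories from INTEGRAL local fractional ideals -/

/-- The classes of the integral fractional ideal `Π_{v ∤ ∞} 𝔭_v^{N(v)}` in abc-iut-w4-d005's integral datum:
`N(v) ∈ ℤ = Γ_v` at the finite place of `v`, `0 ∈ ℝ = Γ_v` at the archimedean places.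
[claim: Mochizuki2012, status: disputed] -/
def exponentCls (N : HeightOneSpectrum (𝓞 F) →₀ ℤ) : ∀ p : Places F, Gamma F p
  | .inl _ => (0 : ℝ)
  | .inr w => (N (FinitePlace.maximalIdeal w) : ℤ)

/-- **The object `Π_v 𝔭_v^{N(v)}` of `(†𝓕⊛_𝔪𝔬𝔡)_α`** determined by an exponent family `N ∈ ⊕_{v∤∞} ℤ·[v]` — an HONEST
fractional ideal of `𝒪_F` (Example 3.6 (ii) "local fractional ideals", `Γ_v = ℤ`), trivial at the archimedean
places; additive in `N`. [claim: Mochizuki2012, status: disputed] -/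
def ofExponents : (HeightOneSpectrum (𝓞 F) →₀ ℤ) →+ FrakObj (Places F) (Gamma F) where
  toFun N := ⟨exponentCls F N, by
    refine ((N.support.finite_toSet.image fun v => (Sum.inr (FinitePlace.mk v) : Places F))).subset ?_
    rintro (v | w) h
    · exact absurd rfl h
    · refine ⟨FinitePlace.maximalIdeal w, ?_, ?_⟩
      · exact Finset.mem_coe.mpr (Finsupp.mem_support_iff.mpr h)
      · show Sum.inr (FinitePlace.mk (FinitePlace.maximalIdeal w)) = Sum.inr w
        rw [FinitePlace.mk_maximalIdeal]⟩
  map_zero' := FrakObj.ext_cls (funext fun p => by rcases p with v | w <;> rfl)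
  map_add' N₁ N₂ := FrakObj.ext_cls (funext fun p => by rcases p with v | w <;> [exact (add_zero _).symm; rfl])

/-- Classes of `ofExponents N` at a finite place: the exponent. [claim: Mochizuki2012, status: disputed] -/
@[simp] theorem ofExponents_cls_inr (N : HeightOneSpectrum (𝓞 F) →₀ ℤ) (w : FinitePlace F) :
    (ofExponents F N).cls (.inr w) = N (FinitePlace.maximalIdeal w) := rfl

/-- Classes of `ofExponents N` at an archimedean place: trivial. [claim: Mochizuki2012, status: disputed] -/
@[simp] theorem ofExponents_cls_inl (N : HeightOneSpectrum (𝓞 F) →₀ ℤ) (v : InfinitePlace F) :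
    (ofExponents F N).cls (.inl v) = (0 : ℝ) := rfl

/-- **Junction with the model of record**: the REALIFICATION ([FrdI] Prop. 5.3 on objects, abc-iut-w4-d005's
`realifyObj`) of the integral ideal `Π_v 𝔭_v^{N(v)}` IS abc-iut-w4-d015's model object of the realified exponent
family (`ofFinDivisorFrak (realifyExponents N)`). [claim: Mochizuki2012, status: disputed] -/
theorem realifyObj_ofExponents (N : HeightOneSpectrum (𝓞 F) →₀ ℤ) :
    realifyObj F (ofExponents F N) = ofFinDivisorFrak (realifyExponents N) := by
  refine FrakObj.ext_cls (funext fun p => ?_)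
  rcases p with v | w
  · rw [realifyObj_cls, realifyCls_inl, ofExponents_cls_inr, FinitePlace.maximalIdeal_mk,
      ofFinDivisorFrak_cls_inl, realifyExponents_apply]
  · rw [realifyObj_cls, realifyCls_inr, ofExponents_cls_inl, ofFinDivisorFrak_cls_inr]

variable {F} (X : PilotData F)

/-- **Prop. 3.7 (v), the object of `(†𝓕⊛_𝔪𝔬𝔡)_j` given by "the local fractional ideals generated by elements of the
monoids … `Ψ_{𝓕_lgp}(†𝓗𝓣^{Θ±ell}NF)_v` for `v ∈ 𝕍^bad`"** at the model of record, INTEGRALLY: the honest ideal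
`Π_{v ∈ 𝕍^bad} 𝔭_v^{ord_v(g_{v,j})}` (exponents = abc-iut-w4-d015's `idealExponents X g j`), an object of
abc-iut-w4-d005's `(†𝓕⊛_𝔪𝔬𝔡)_α = Ffrak F`. [claim: Mochizuki2012, status: disputed] -/
def idealObj (g : ∀ v ∈ X.S, Fin X.lstar → (v.adicCompletion F)ˣ) (i : Fin X.lstar) : Ffrak F :=
  FrakCat.of (ofExponents F (idealExponents X g i))

/-- **"together with the products of realification functors … one obtains"**: the realification FUNCTOR applied
to the integral ideal object of `g` yields abc-iut-w4-d015's model object `objOfFrakModel X g j`.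
[claim: Mochizuki2012, status: disputed] -/
theorem realification_idealObj (g : ∀ v ∈ X.S, Fin X.lstar → (v.adicCompletion F)ˣ) (i : Fin X.lstar) :
    ((realification F).obj (idealObj X g i)).obj = objOfFrakModel X g i :=
  realifyObj_ofExponents F (idealExponents X g i)

/-- `l⋆ ≥ 1` for pilot data (`l ≥ 5`). [cite: DupuyHilado2025, §3.3] -/
theorem lstar_pos : 0 < X.lstar := lt_of_lt_of_le two_pos X.two_le_lstar

/-- **The object of `†𝒞^⊩_lgp` determined by `g`** (Prop. 3.7 (v) "objects of the [global!] categories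
`𝒞^⊩_lgp(†𝓗𝓣^{Θ±ell}NF)`, `𝒞^⊩_LGP(†𝓗𝓣^{Θ±ell}NF)`"; Def. 3.8 (i) "its realification, regarded as an object of
`†𝒞^⊩_LGP` or `†𝒞^⊩_lgp`"): the realification of the label-`1` ideal object (weight `1² = 1`) — for `g` in the
printed splitting monoids the whole realified family is its weighted-diagonal image
(`realification_idealObj_eq_embDiag`). [claim: Mochizuki2012, status: disputed] -/
def lgpObj (g : ∀ v ∈ X.S, Fin X.lstar → (v.adicCompletion F)ˣ) : FrakRlfCat F :=
  (realification F).obj (idealObj X g (firstLabel (lstar_pos X)))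

/-- `lgpObj X g` has underlying real family `objOfFrakModel X g 1`. [claim: Mochizuki2012, status: disputed] -/
theorem lgpObj_obj (g : ∀ v ∈ X.S, Fin X.lstar → (v.adicCompletion F)ˣ) :
    (lgpObj X g).obj = objOfFrakModel X g (firstLabel (lstar_pos X)) :=
  realification_idealObj X g _

variable (τ : ∀ v ∈ X.S, (v.adicCompletion F)ˣ)
  (hτ : ∀ v (hv : v ∈ X.S), ‖(τ v hv : v.adicCompletion F)‖ < 1 ∧
    tateJ (τ v hv : v.adicCompletion F) = (X.jE : v.adicCompletion F))
  (ρ : ∀ v ∈ X.S, (v.adicCompletion F)ˣ) (hρ : ∀ v (hv : v ∈ X.S), ρ v hv ^ (2 * X.l) = τ v hv)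
  (ζ : ∀ v ∈ X.S, Fin X.lstar → ((v.adicCompletion F)ˣ)ˣ)
  (hζ : ∀ v (hv : v ∈ X.S) (i : Fin X.lstar), ζ v hv i ∈ rootsOfUnity (2 * X.l) ((v.adicCompletion F)ˣ))

include hζ in
/-- `ord_v` along the printed value-profile `ξ_v = (ζ_{v,j}·q̲_v^{j²})_j`: `ord_v(ξ_{v,j}) = j²·ord_v(q̲_v)` (the torsion
`ζ_{v,j}` has `ord_v = 0`). [claim: Mochizuki2012, status: disputed] -/
theorem ordv_rootProfile_eq (v : HeightOneSpectrum (𝓞 F)) (hv : v ∈ X.S) (i : Fin X.lstar) :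
    CompletionModel.ordv F v (rootProfile X ρ ζ v hv i) = (sqWt i : ℤ) * CompletionModel.ordv F v (ρ v hv) := by
  have hζ0 : CompletionModel.ordv F v (ζ v hv i : (v.adicCompletion F)ˣ) = 0 :=
    ordv_eq_zero_of_pow_eq_one F v (twoL_pos X) ((mem_rootsOfUnity' _ _).mp (hζ v hv i))
  rw [rootProfile_apply, ordv_mul, hζ0, zero_add, ordv_pow]
  simp [sqWt, labelNat]

include hζ in
/-- **Elements of the printed splitting monoid are weighted-diagonal in `ord_v`**: for `g_v ∈ Ψ^⊥_v =
μ_{2l}^{diag}·ξ_v^ℕ`, `ord_v(g_{v,j}) = j² · ord_v(g_{v,1})`. [claim: Mochizuki2012, status: disputed] -/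
theorem ordv_eq_sqWt_mul_of_mem (v : HeightOneSpectrum (𝓞 F)) (hv : v ∈ X.S)
    {x : Fin X.lstar → (v.adicCompletion F)ˣ} (hx : x ∈ (SplittingMonoids.dhRoot X ρ ζ).Msplit v hv)
    (i : Fin X.lstar) :
    CompletionModel.ordv F v (x i) = (sqWt i : ℤ) * CompletionModel.ordv F v (x (firstLabel (lstar_pos X))) := by
  rw [dhRoot_Msplit] at hx
  obtain ⟨ω, hω, n, rfl⟩ := (mem_gaussianSplittingMonoid_iff _ _ x).mp hx
  have hω0 : CompletionModel.ordv F v (ω : (v.adicCompletion F)ˣ) = 0 :=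
    ordv_eq_zero_of_pow_eq_one F v (twoL_pos X) ((mem_rootsOfUnity' _ _).mp hω)
  have hprof : ∀ k : Fin X.lstar,
      CompletionModel.ordv F v (valueProfileOf (ρ v hv) (fun i => labelNat i ^ 2) (ζ v hv) k) =
        (sqWt k : ℤ) * CompletionModel.ordv F v (ρ v hv) := fun k =>
    ordv_rootProfile_eq X ρ ζ hζ v hv k
  have h1 : ∀ k : Fin X.lstar,
      CompletionModel.ordv F v ((ω : (v.adicCompletion F)ˣ) * valueProfileOf (ρ v hv) (fun i => labelNat i ^ 2)
        (ζ v hv) k ^ n) = n * ((sqWt k : ℤ) * CompletionModel.ordv F v (ρ v hv)) := fun k => by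
    rw [ordv_mul, hω0, zero_add, ordv_pow, hprof k]
  dsimp only
  rw [h1 i, h1 (firstLabel (lstar_pos X)), sqWt_firstLabel, Nat.cast_one, one_mul]
  ring

include hζ in
/-- For `g` in the printed splitting monoids, the integral ideal objects are weighted-diagonal:
`Π_v 𝔭_v^{ord_v(g_{v,j})} = (Π_v 𝔭_v^{ord_v(g_{v,1})})^{⊗ j²}`. [claim: Mochizuki2012, status: disputed] -/
theorem ofExponents_idealExponents_eq_nsmul_of_mem (g : ∀ v ∈ X.S, Fin X.lstar → (v.adicCompletion F)ˣ)
    (hg : ∀ v hv, g v hv ∈ (SplittingMonoids.dhRoot X ρ ζ).Msplit v hv) (i : Fin X.lstar) :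
    ofExponents F (idealExponents X g i) =
      sqWt i • ofExponents F (idealExponents X g (firstLabel (lstar_pos X))) := by
  refine FrakObj.ext_cls (funext fun p => ?_)
  rcases p with v | w
  · rw [FrakObj.cls_nsmul, ofExponents_cls_inl, ofExponents_cls_inl, nsmul_zero]
  · rw [FrakObj.cls_nsmul, ofExponents_cls_inr, ofExponents_cls_inr]
    show idealExponents X g i (FinitePlace.maximalIdeal w) =
      (sqWt i : ℤ) * idealExponents X g (firstLabel (lstar_pos X)) (FinitePlace.maximalIdeal w)
    by_cases hw : FinitePlace.maximalIdeal w ∈ X.S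
    · rw [idealExponents_apply_of_mem X g i hw, idealExponents_apply_of_mem X g _ hw,
        ordv_eq_sqWt_mul_of_mem X ρ ζ hζ _ hw (hg _ hw) i]
    · rw [idealExponents_apply_of_not_mem X g i hw, idealExponents_apply_of_not_mem X g _ hw, mul_zero]

include hζ in
/-- **Def. 3.8 (i) at the category level: "its realification, regarded as an object of `†𝒞^⊩_LGP` or
`†𝒞^⊩_lgp`"** — for `g` in the printed splitting monoids `Ψ^⊥_{𝓕_lgp,v}`, the product of realification functors
applied to the family of integral ideal objects `(idealObj X g j)_j` IS the weighted-diagonal image of the single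
object `lgpObj X g` of `†𝒞^⊩_lgp` (the square of Prop. 3.7 (v) read on these objects).
[claim: Mochizuki2012, status: disputed] -/
theorem realification_idealObj_eq_embDiag (g : ∀ v ∈ X.S, Fin X.lstar → (v.adicCompletion F)ˣ)
    (hg : ∀ v hv, g v hv ∈ (SplittingMonoids.dhRoot X ρ ζ).Msplit v hv) :
    (realificationProd F X.lstar).obj (fun i => idealObj X g i) = (embDiag F X.lstar).obj (lgpObj X g) := by
  funext i
  rw [realificationProd_obj]
  rw [← FrakRlfCat.of_obj ((realification F).obj (idealObj X g i)),
    ← FrakRlfCat.of_obj ((embDiag F X.lstar).obj (lgpObj X g) i)]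
  congr 1
  rw [realification_obj_obj, embDiag_obj_obj, lgpObj, realification_obj_obj]
  show realifyObj F (ofExponents F (idealExponents X g i)) =
    sqWt i • realifyObj F (ofExponents F (idealExponents X g (firstLabel (lstar_pos X))))
  rw [ofExponents_idealExponents_eq_nsmul_of_mem X ρ ζ hζ g hg i, ← realifyObjHom_apply,
    ← realifyObjHom_apply, map_nsmul]

/-! ### §4 The categorical inhabitant of `GlobalLGPFrobenioidSignature` -/

/-- The Frobenioids of Prop. 3.7 AS CATEGORIES at the number-field model (values in Mathlib's `Cat`), indexed by
abc-iut-L6-t4's names together with a realification flag: non-realified `(†𝓕⊛_MOD)_j`, `(†𝓕⊛_mod)_j`,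
`(†𝓕⊛_𝔪𝔬𝔡)_j` ↦ the integral fractional-ideal Frobenioid `Ffrak F` (identified along the natural isomorphisms of
Prop. 3.7 (i)(ii), as print does, p. 110 l. 22; distinct models: `isoFrakMODCat`, `Prop37.isoFrakMod`); their
realifications `(†𝓕⊛ℝ_*)_j` ↦ `FrakRlfCat F` ([FrdI] Prop. 5.3); `†𝒞^⊩_LGP`, `†𝒞^⊩_lgp` (already realified;
"isomorphic to `𝒞^⊩_mod`") ↦ `FrakRlfCat F`. [claim: Mochizuki2012, status: disputed] -/
def catOf : LGPFrobenioidName X.lstar × Bool → Cat.{0, 0}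
  | ⟨.MOD _, false⟩ => Cat.of (Ffrak F)
  | ⟨.smallMod _, false⟩ => Cat.of (Ffrak F)
  | ⟨.frak _, false⟩ => Cat.of (Ffrak F)
  | ⟨.CLGP, false⟩ => Cat.of (FrakRlfCat F)
  | ⟨.Clgp, false⟩ => Cat.of (FrakRlfCat F)
  | ⟨_, true⟩ => Cat.of (FrakRlfCat F)

/-- Name-level realification: `(†𝓕⊛_*)_j ↦ (†𝓕⊛ℝ_*)_j` (set the flag). [claim: Mochizuki2012, status: disputed] -/
def realifyName : LGPFrobenioidName X.lstar × Bool → LGPFrobenioidName X.lstar × Bool := fun A => (A.1, true)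

/-- The realification FUNCTOR behind `realifyName` on the non-realified `(†𝓕⊛_𝔪𝔬𝔡)_j`: abc-iut-w5-d153's
`Prop37.realification F : (†𝓕⊛_𝔪𝔬𝔡)_j ⥤ (†𝓕⊛ℝ_𝔪𝔬𝔡)_j` ([FrdI] Prop. 5.3), with the types literally
`catOf (frak j, false) ⥤ catOf (realifyName (frak j, false))`. [claim: Mochizuki2012, status: disputed] -/
def realifyFunctorFrak (j : Fin X.lstar) :
    (catOf X (.frak j, false) : Type) ⥤ (catOf X (realifyName X (.frak j, false)) : Type) :=
  realification F

/-- **`frobenioidSignature X` — the output signature of [IUTchIII] Prop. 3.7 inhabited at the CATEGORY level of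
record**: Frobenioids = the categories `catOf`, isomorphisms of Frobenioids = EQUIVALENCES OF CATEGORIES
((i)(ii): identity equivalences of the identified model; (v): `isoCLGPlgpCat`), object types = objects of those
categories, realification = `realifyName` ([FrdI] Prop. 5.3: `Ffrak F ↦ FrakRlfCat F`), `𝓕^⊩`-prime-strips =
abc-iut-L6-t4's names with singleton isomorphism types (the full poly-isomorphisms of Def. 3.8 (ii) carry no data
at this level), realified product embeddings (v) = the weighted-diagonal functor `embDiag` on objects
(INJECTIVE, `embDiag_obj_injective`; functor-level: faithful, `embDiag_faithful`), monoids at `v ∈ 𝕍^bad` =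
`Π_{j∈𝔽_l^⋇} F_vˣ` (as in abc-iut-w4-d015's `frakSignatureRoot`), object-forming maps (v) = the INTEGRAL ideal
objects `idealObj X` and their realification `lgpObj X`. [claim: Mochizuki2012, status: disputed] -/
def _root_.Literature.IUT.LogThetaLattice.frobenioidSignature :
    GlobalLGPFrobenioidSignature X.lstar (HeightOneSpectrum (𝓞 F)) (· ∈ X.S)
      (LGPFrobenioidName X.lstar × Bool) (fun A B => (catOf X A : Type) ≌ (catOf X B : Type))
      (fun A => (catOf X A : Type)) (realifyName X) LGPStripName (fun _ _ => Unit)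
      (fun v (_ : v ∈ X.S) => Fin X.lstar → (v.adicCompletion F)ˣ) where
  FMOD j := (.MOD j, false)
  Fmod j := (.smallMod j, false)
  Ffrak j := (.frak j, false)
  isoModMOD _ := CategoryTheory.Equivalence.refl
  isoModFrak _ := CategoryTheory.Equivalence.refl
  isoFrakMOD _ := CategoryTheory.Equivalence.refl
  CLGP := (.CLGP, false)
  Clgp := (.Clgp, false)
  FLGP := .LGP
  Flgp := .lgp
  Fgau := .gau
  isoGauLGP := ()
  isoLGPlgp := ()
  isoCLGPlgp := isoCLGPlgpCat F
  embLGP Y := (embDiag F X.lstar).obj Y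
  embLgp Y := (embDiag F X.lstar).obj Y
  embLGP_injective := embDiag_obj_injective (lstar_pos X)
  embLgp_injective := embDiag_obj_injective (lstar_pos X)
  objOfLgp := lgpObj X
  objOfLGP := lgpObj X
  objOfFrak := idealObj X
  objOfMOD := idealObj X

/-- The lgp object-forming map of `frobenioidSignature X` factors through abc-iut-L6-t4's root-convention
lgp-divisor `thetaObjOfRoot X g` via its label-`1` component, embedded by abc-iut-w4-d015's `ofFinDivisorFrak`.
[claim: Mochizuki2012, status: disputed] -/
theorem objOfLgp_frobenioidSignature_eq (g : ∀ v ∈ X.S, Fin X.lstar → (v.adicCompletion F)ˣ) :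
    (frobenioidSignature X).objOfLgp g =
      FrakRlfCat.of (ofFinDivisorFrak (thetaObjOfRoot X g (firstLabel (lstar_pos X)))) := by
  show lgpObj X g = _
  rw [← FrakRlfCat.of_obj (lgpObj X g), lgpObj_obj, objOfFrakModel, realifyExponents_idealExponents]

include hτ hρ hζ in
/-- **The Θ-pilot object of [IUTchIII] Def. 3.8 (i) in the categorical signature**, as an object of `†𝒞^⊩_lgp`: for
the printed splitting monoids `Ψ^⊥_{𝓕_lgp,v} = μ_{2l}^{diag}·(ζ_j q̲_v^{j²})_j^ℕ` its underlying real family is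
abc-iut-w4-d015's `ofFinDivisorFrak` of abc-iut-c312-3's `q`-pilot divisor `P_q = Σ_v ord_v(q̲_v)[v]` (the label-`1`
theta pilot `P_{Θ,1} = 1²·P_q`) — whatever generators up to torsion are chosen.
[claim: Mochizuki2012, status: disputed] -/
theorem thetaPilotObject_frobenioidSignature :
    thetaPilotObject (frobenioidSignature X) (SplittingMonoids.dhRoot X ρ ζ) =
      FrakRlfCat.of (ofFinDivisorFrak X.qPilot) := by
  have h := thetaPilotObject_eq_of_factors_root X τ hτ ρ hρ ζ hζ (frobenioidSignature X)
    (fun P => FrakRlfCat.of (ofFinDivisorFrak (P (firstLabel (lstar_pos X)))))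
    (objOfLgp_frobenioidSignature_eq X)
  rw [h]
  show FrakRlfCat.of (ofFinDivisorFrak (X.thetaPilot (firstLabel (lstar_pos X)))) = _
  rw [PilotData.thetaPilot_eq_smul]
  simp [firstLabel]

include hτ hρ hζ in
/-- … and its image under the realified product embedding `†𝒞^⊩_LGP ↪ Π_j (†𝓕⊛ℝ_MOD)_j` is the family
`(P_{Θ,j})_j = (j²·P_q)_j` read as objects of the realified Frobenioids (abc-iut-w4-d015's `ofLgpDivisor X.thetaPilot`,
abc-iut-c312-3's theta-pilot lgp-divisor `P_Θ`). [claim: Mochizuki2012, status: disputed] -/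
theorem embLGP_thetaPilotObject_frobenioidSignature (i : Fin X.lstar) :
    ((frobenioidSignature X).embLGP
        (thetaPilotObject (frobenioidSignature X) (SplittingMonoids.dhRoot X ρ ζ)) i).obj =
      ofLgpDivisor X.thetaPilot i := by
  rw [thetaPilotObject_frobenioidSignature X τ hτ ρ hρ ζ hζ]
  show ((embDiag F X.lstar).obj (FrakRlfCat.of (ofFinDivisorFrak X.qPilot)) i).obj = ofFinDivisorFrak (X.thetaPilot i)
  rw [embDiag_obj_obj, FrakRlfCat.obj_of, PilotData.thetaPilot_eq_smul]
  refine FrakObj.ext_cls (funext fun p => ?_)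
  rcases p with w | v
  · rw [FrakObj.cls_nsmul, ofFinDivisorFrak_cls_inl, ofFinDivisorFrak_cls_inl, Finsupp.smul_apply,
      nsmul_eq_mul, smul_eq_mul]
    simp [sqWt]
  · rw [FrakObj.cls_nsmul, ofFinDivisorFrak_cls_inr, ofFinDivisorFrak_cls_inr, nsmul_zero]

include hτ hρ hζ in
/-- `thetaPilotObject_wellDefined` ([IUTchIII] Def. 3.8 (i) "determined by ANY collection … of generators up to
torsion") HOLDS for the categorical signature. [claim: Mochizuki2012, status: disputed] -/
theorem thetaPilotObject_wellDefined_frobenioidSignature :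
    thetaPilotObject_wellDefined (frobenioidSignature X) (SplittingMonoids.dhRoot X ρ ζ) :=
  thetaPilotObject_wellDefined_of_factors_root X τ hτ ρ hρ ζ hζ (frobenioidSignature X)
    (fun P => FrakRlfCat.of (ofFinDivisorFrak (P (firstLabel (lstar_pos X)))))
    (objOfLgp_frobenioidSignature_eq X)

include hζ in
/-- **The square of Prop. 3.7 (v) on the Θ-side objects of the categorical signature**: for every `g` in the printed
splitting monoids, embedding the lgp-object equals realifying the `𝔪𝔬𝔡`-objects componentwise.
[claim: Mochizuki2012, status: disputed] -/
theorem frobenioidSignature_square (g : ∀ v ∈ X.S, Fin X.lstar → (v.adicCompletion F)ˣ)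
    (hg : ∀ v hv, g v hv ∈ (SplittingMonoids.dhRoot X ρ ζ).Msplit v hv) :
    (frobenioidSignature X).embLgp ((frobenioidSignature X).objOfLgp g) =
      (realificationProd F X.lstar).obj ((frobenioidSignature X).objOfFrak g) :=
  (realification_idealObj_eq_embDiag X ρ ζ hζ g hg).symm

end Prop37

end Literature.IUT.LogThetaLattice

end
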